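import Mathlib.Analysis.InnerProductSpace.Calculus
import Mathlib.Analysis.InnerProductSpace.Orthonormal
import Mathlib.Analysis.Calculus.ContDiff.Operations
import Mathlib.LinearAlgebra.LinearIndependent.Lemmas

/-!
# Smooth Gram–Schmidt: orthonormalising a smooth, pointwise independent family with smooth
# triangular coefficients

Topic `Geometry/Riemannian` (fact seat
`provefact-Literature.Geometry.Riemannian.LawsonMichelsohn1984_surrounding`).  Everything here
is **proved**; no definitions.

In the junction of Lawson–Michelsohn's surrounding construction (§3) the normal coordinate
`Y₀ = y⃗ ∘ e` of a Morse chart has to be *normalised* along the descending disc so that `DY`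
becomes a co-isometry there (then `‖Y‖` is the distance to the disc to first order and the tube
`{‖Y‖ = r}` has mean curvature `(k - 1)/r` to leading order).  The normaliser is the Gram–Schmidt
process applied to the gradients `∇(Y₀)ⱼ(p)`, `p` on the disc; what is needed is that its
**coefficients depend smoothly on the point**.  This file proves exactly that, by the explicit
recursion of the process:

* `exists_smooth_gramSchmidt_coeff` — for vector fields `v₀, …, v_{k-1} : P → V` (inner product
  space `V`, parameters in a normed space `P`), `C^∞` on a set `U` and linearly independent
  at every point of `U`, there are `C^∞` coefficient functions `c l j : P → ℝ` on `U`, lower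
  triangular (`c l j = 0` for `j > l`) with positive diagonal, such that the fields
  `u_l = ∑ⱼ c l j • vⱼ`, `l < k`, are orthonormal at every point of `U`.

## References

* H. B. Lawson, Jr., M.-L. Michelsohn, *Embedding and surrounding with positive mean curvature*,
  Invent. Math. 77 (1984), §3 (the tube around the handle core). [LawsonMichelsohn1984]
-/

noncomputable section

open Set Function Finset
open scoped RealInnerProductSpace ContDiff

namespace Literature.Geometry.Riemannian

variable {P V : Type*} [NormedAddCommGroup P] [NormedSpace ℝ P] [NormedAddCommGroup V]
  [InnerProductSpace ℝ V]

/-- **Smooth Gram–Schmidt with triangular coefficients.**  Let `v j : P → V` (`j < k`) be `C^∞`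
on the set `U` and linearly independent at every point of `U`.  Then there are coefficient
functions `c l j : P → ℝ`, `C^∞` on `U`, with `c l j = 0` for `j > l` and `c l l > 0` on `U`
(`l < k`), such that at every `p ∈ U` the vectors `u_l(p) = ∑_{j < k} c l j p • v j p`,
`l < k`, are orthonormal. [folklore] -/
theorem exists_smooth_gramSchmidt_coeff {U : Set P} (k : ℕ) (v : ℕ → P → V)
    (hv : ∀ j < k, ContDiffOn ℝ ∞ (v j) U)
    (hli : ∀ p ∈ U, LinearIndependent ℝ (fun j : Fin k => v j p)) :
    ∃ c : ℕ → ℕ → P → ℝ, (∀ l j, ContDiffOn ℝ ∞ (c l j) U) ∧ (∀ l j, l < j → c l j = 0) ∧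
      (∀ p ∈ U, ∀ l < k, 0 < c l l p) ∧
      ∀ p ∈ U, Orthonormal ℝ (fun l : Fin k => ∑ j ∈ range k, c l j p • v j p) := by
  classical
  -- induction on the number `i` of rows already built (rows `≥ i` are zero)
  suffices H : ∀ i ≤ k, ∃ c : ℕ → ℕ → P → ℝ, (∀ l j, ContDiffOn ℝ ∞ (c l j) U) ∧
      (∀ l j, l < j → c l j = 0) ∧ (∀ l, i ≤ l → ∀ j, c l j = 0) ∧
      (∀ p ∈ U, ∀ l < i, 0 < c l l p) ∧
      ∀ p ∈ U, Orthonormal ℝ (fun l : Fin i => ∑ j ∈ range k, c l j p • v j p) by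
    obtain ⟨c, hc, htri, -, hdiag, horth⟩ := H k le_rfl
    exact ⟨c, hc, htri, hdiag, horth⟩
  intro i
  induction i with
  | zero =>
    intro _
    refine ⟨fun _ _ _ => 0, fun l j => contDiffOn_const, fun l j _ => rfl, fun l _ j => rfl,
      fun p _ l hl => absurd hl (Nat.not_lt_zero l), fun p _ => ?_⟩
    exact orthonormal_iff_ite.2 fun l => l.elim0
  | succ i ih =>
    intro hik
    have hi : i < k := Nat.lt_of_succ_le hik
    obtain ⟨c, hc, htri, hzero, hdiag, horth⟩ := ih hi.le
    -- the rows built so far, as vector fields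
    set u : ℕ → P → V := fun l p => ∑ j ∈ range k, c l j p • v j p with hu
    have husm : ∀ l, ContDiffOn ℝ ∞ (u l) U := fun l =>
      ContDiffOn.sum fun j hj => (hc l j).smul (hv j (mem_range.1 hj))
    -- `u l p ∈ span {v j p | j < i}` for `l < i`
    have huspan : ∀ p, ∀ l < i, u l p ∈ Submodule.span ℝ ((fun j : Fin k => v j p) '' {j | j.val < i}) := by
      intro p l hl
      refine Submodule.sum_mem _ fun j hj => ?_
      by_cases hjl : l < j
      · rw [htri l j hjl]; simp
      · refine Submodule.smul_mem _ _ (Submodule.subset_span ⟨⟨j, mem_range.1 hj⟩, ?_, rfl⟩)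
        show j < i
        omega
    -- the new vector `w = v i - ∑_{l < i} ⟨u l, v i⟩ u l`, smooth and nonvanishing on `U`
    set w : P → V := fun p => v i p - ∑ l ∈ range i, ⟪u l p, v i p⟫ • u l p with hw
    have hwsm : ContDiffOn ℝ ∞ w U :=
      (hv i hi).sub (ContDiffOn.sum fun l _ => ((husm l).inner ℝ (hv i hi)).smul (husm l))
    have hwne : ∀ p ∈ U, w p ≠ 0 := by
      intro p hp h0
      have hmem : v i p ∈ Submodule.span ℝ ((fun j : Fin k => v j p) '' {j | j.val < i}) := by
        have : v i p = ∑ l ∈ range i, ⟪u l p, v i p⟫ • u l p := by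
          have := h0; rw [hw] at this; exact sub_eq_zero.1 this
        rw [this]
        exact Submodule.sum_mem _ fun l hl => Submodule.smul_mem _ _ (huspan p l (mem_range.1 hl))
      have hnot := (hli p hp).notMem_span_image (s := {j : Fin k | j.val < i}) (x := ⟨i, hi⟩)
        (by simp)
      exact hnot hmem
    have hnorm_sm : ContDiffOn ℝ ∞ (fun p => ‖w p‖) U := fun p hp =>
      (hwsm p hp).norm ℝ (hwne p hp)
    have hnorm_pos : ∀ p ∈ U, 0 < ‖w p‖ := fun p hp => norm_pos_iff.2 (hwne p hp)
    -- `w` is orthogonal to the previous rows, on `U`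
    have horth' : ∀ p ∈ U, ∀ l < i, ∀ l' < i, ⟪u l p, u l' p⟫ = if l = l' then 1 else 0 := by
      intro p hp l hl l' hl'
      have h := (orthonormal_iff_ite.1 (horth p hp)) ⟨l, hl⟩ ⟨l', hl'⟩
      simp only [Fin.mk.injEq] at h
      exact h
    have hwu : ∀ p ∈ U, ∀ l < i, ⟪u l p, w p⟫ = 0 := by
      intro p hp l hl
      rw [hw]
      simp only [inner_sub_right, inner_sum, real_inner_smul_right]
      rw [Finset.sum_eq_single l (fun l' hl' hne => by
          rw [horth' p hp l hl l' (mem_range.1 hl'), if_neg (Ne.symm hne), mul_zero])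
        (fun h => absurd (mem_range.2 hl) h)]
      rw [horth' p hp l hl l hl, if_pos rfl, mul_one, sub_self]
    -- the new coefficient row
    set row : ℕ → P → ℝ := fun j p =>
      ((if j = i then 1 else 0) - ∑ l ∈ range i, ⟪u l p, v i p⟫ * c l j p) / ‖w p‖ with hrow
    have hrowsm : ∀ j, ContDiffOn ℝ ∞ (row j) U := fun j =>
      (contDiffOn_const.sub (ContDiffOn.sum fun l _ => ((husm l).inner ℝ (hv i hi)).mul (hc l j))).div
        hnorm_sm fun p hp => (hnorm_pos p hp).ne'
    -- the combination of the new row is `w / ‖w‖`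
    have hrow_comb : ∀ p, ∑ j ∈ range k, row j p • v j p = ‖w p‖⁻¹ • w p := by
      intro p
      have e1 : ∀ j ∈ range k, row j p • v j p =
          ‖w p‖⁻¹ • ((if j = i then (1 : ℝ) else 0) • v j p - ∑ l ∈ range i, (⟪u l p, v i p⟫ * c l j p) • v j p) := by
        intro j _
        rw [hrow]
        simp only [div_eq_inv_mul, mul_smul, sub_smul, Finset.sum_smul]
      rw [Finset.sum_congr rfl e1, ← Finset.smul_sum, Finset.sum_sub_distrib]
      congr 1
      have e2 : ∑ j ∈ range k, (if j = i then (1 : ℝ) else 0) • v j p = v i p := by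
        rw [Finset.sum_eq_single i (fun j _ hne => by rw [if_neg hne, zero_smul])
          (fun h => absurd (mem_range.2 hi) h), if_pos rfl, one_smul]
      have e3 : ∑ j ∈ range k, ∑ l ∈ range i, (⟪u l p, v i p⟫ * c l j p) • v j p =
          ∑ l ∈ range i, ⟪u l p, v i p⟫ • u l p := by
        rw [Finset.sum_comm]
        refine Finset.sum_congr rfl fun l _ => ?_
        rw [hu]
        simp only [Finset.smul_sum, mul_smul]
      rw [e2, e3]
    -- the new coefficient matrix
    set c' : ℕ → ℕ → P → ℝ := fun l => if l = i then row else c l with hc'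
    have hc'old : ∀ l, l ≠ i → c' l = c l := fun l hl => by simp [hc', hl]
    have hc'new : c' i = row := by simp [hc']
    refine ⟨c', fun l j => ?_, fun l j hlj => ?_, fun l hl j => ?_, fun p hp l hl => ?_, fun p hp => ?_⟩
    · -- smoothness
      by_cases hl : l = i
      · rw [hl, hc'new]; exact hrowsm j
      · rw [hc'old l hl]; exact hc l j
    · -- triangularity
      by_cases hl : l = i
      · subst hl
        rw [hc'new]
        funext p
        have h1 : (if j = l then (1 : ℝ) else 0) = 0 := if_neg (by omega)
        have h2 : ∑ l' ∈ range l, ⟪u l' p, v l p⟫ * c l' j p = 0 :=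
          Finset.sum_eq_zero fun l' hl' => by
            rw [htri l' j (by have := mem_range.1 hl'; omega)]; simp
        show row j p = 0
        rw [hrow]
        dsimp only
        rw [h1, h2, sub_zero, zero_div]
      · rw [hc'old l hl]; exact htri l j hlj
    · -- rows `≥ i + 1` vanish
      have hl' : l ≠ i := by omega
      rw [hc'old l hl']
      exact hzero l (by omega) j
    · -- positive diagonal
      by_cases hli' : l = i
      · subst hli'
        rw [hc'new, hrow]
        dsimp only
        have h2 : ∑ l' ∈ range l, ⟪u l' p, v l p⟫ * c l' l p = 0 :=
          Finset.sum_eq_zero fun l' hl' => by rw [htri l' l (mem_range.1 hl')]; simp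
        rw [if_pos rfl, h2, sub_zero]
        exact div_pos one_pos (hnorm_pos p hp)
      · rw [hc'old l hli']
        exact hdiag p hp l (by omega)
    · -- orthonormality of the `i + 1` rows
      have hcomb_old : ∀ l < i, ∑ j ∈ range k, c' l j p • v j p = u l p := fun l hl => by
        rw [hc'old l (by omega)]
      have hcomb_new : ∑ j ∈ range k, c' i j p • v j p = ‖w p‖⁻¹ • w p := by
        rw [hc'new]; exact hrow_comb p
      have hunit : ⟪‖w p‖⁻¹ • w p, ‖w p‖⁻¹ • w p⟫ = 1 := by
        rw [real_inner_smul_left, real_inner_smul_right, real_inner_self_eq_norm_sq]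
        field_simp [(hnorm_pos p hp).ne']
      rw [orthonormal_iff_ite]
      intro l l'
      rcases Nat.lt_succ_iff_lt_or_eq.1 l.isLt with hl | hl <;>
        rcases Nat.lt_succ_iff_lt_or_eq.1 l'.isLt with hl' | hl'
      · -- both old
        show ⟪∑ j ∈ range k, c' l.val j p • v j p, ∑ j ∈ range k, c' l'.val j p • v j p⟫ = _
        rw [hcomb_old _ hl, hcomb_old _ hl', horth' p hp _ hl _ hl']
        by_cases h : l = l'
        · subst h; simp
        · rw [if_neg (fun h' => h (Fin.ext h')), if_neg h]
      · -- `l` old, `l' = i`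
        show ⟪∑ j ∈ range k, c' l.val j p • v j p, ∑ j ∈ range k, c' l'.val j p • v j p⟫ = _
        rw [hcomb_old _ hl, hl', hcomb_new, real_inner_smul_right, hwu p hp _ hl, mul_zero]
        rw [if_neg]
        intro h; rw [h] at hl; omega
      · -- `l = i`, `l'` old
        show ⟪∑ j ∈ range k, c' l.val j p • v j p, ∑ j ∈ range k, c' l'.val j p • v j p⟫ = _
        rw [hcomb_old _ hl', hl, hcomb_new, real_inner_smul_left, real_inner_comm, hwu p hp _ hl',
          mul_zero, if_neg]
        intro h; rw [← h] at hl'; omega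
      · -- both new
        show ⟪∑ j ∈ range k, c' l.val j p • v j p, ∑ j ∈ range k, c' l'.val j p • v j p⟫ = _
        rw [hl, hl', hcomb_new, hunit, if_pos (Fin.ext (hl.trans hl'.symm))]

end Literature.Geometry.Riemannian

end
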